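import Literature.AnabelianGeometry.SemiGraphs.TemperedCompactPairDistanceOne
import HarnessLib

/-!
# Two subgroups of `π₁^temp(𝒢)` at tree distance `≥ 2`: the SEPARATING EDGE of the level tree, ORIENTED, and its
# separating vertex

Mochizuki, *Semi-graphs of anabelioids*, Publ. RIMS **42** (2006), §1, Lemma 1.8 (ii) p. 20, §3, Theorem 3.7
(iii)/(iv) pp. 40–41 [cite: MochizukiSemiAnbd2006, Thm 3.7(iv) p.41].

PROOF-ONLY tool file (abc-iut cell, layer L3, row «T37iv-S2@RELATIVE-BRIDGE», file F3a, seat abc-iut-L3-t8 gen 10;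
no definition, no named fact).  Preparation of the third regime of the trichotomy of
`TemperedCompactPairBridgeRelative.lean` (F1) / `TemperedCompactPairDistanceOne.lean` (F2): `K₁`, `K₂ ≤ π₁^temp(𝒢)`
fix no common vertex of `𝒢_{∞,m}`.  For ANY countable `𝒢` with the hypotheses of Prop. 3.6, canonical tower, ANY
subgroups (no compactness, no estrangement):

* `SemiGraph.exists_crossing_of_walk` — the CROSSING LEMMA: for an adjacency-preserving map of nodes `f`, a node
  `c` and a node set `D ∌ c` closed under adjacency away from `c`, a walk whose image starts in `D` and ends outside
  `D ∪ {c}` has three CONSECUTIVE nodes mapping to `(d, c, d')` with `d ∈ D`, `d' ∉ D ∪ {c}` — an UNFOLDED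
  crossing of `c`;
* `SemiGraph.inl_mem_support_of_edge_mem_support` — walks to `a₀` through the point of an edge `e₀` pass the
  vertex `z₁` of the `a₀`-side branch of `e₀`;
* `exists_separating_edge_data` — at a level with no common fixed vertex the separating edge `e₀` of Lemma 1.8
  (ii) (family form) comes ORIENTED: branches `b₁ ≠ b₂` (towards the `K₁`-, resp. `K₂`-fixed locus) with their
  vertices `z₁`, `z₂` and the side-reachability facts;
* `separating_vertex_package` — if `z₁` is not fixed by `K₁`, then `z₁` is not fixed by `K₂` either, every walk
  from a `K₂`-fixed vertex to `a₀` passes `z₁`, and every `K₁`-fixed vertex reaches `a₀` avoiding `z₁`.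

Sequel (F3b, `TemperedCompactPairUnfoldedCrossing.lean`): unfolded crossings of the separating vertex at every
deeper level.  Honest framing: generic statements about OUR typed `π₁^temp`; nothing here bears on [IUTchIII]
Cor. 3.12; no side taken; typed ≠ proved.
-/
noncomputable section

open CategoryTheory Topology

namespace Literature.AnabelianGeometry.SemiGraphs

open SimpleGraph

universe u

namespace SemiGraph

/-- **CROSSING LEMMA.**  Let `f : G.Node → G'.Node` preserve adjacency of the barycentric subdivisions, `c` a node
of `G'` and `D` a set of nodes of `G'` not containing `c` and closed under adjacency away from `c`.  A walk of `G`
whose image starts in `D` and ends outside `D ∪ {c}` contains three consecutive nodes `g ~ g' ~ g''` with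
`f g ∈ D`, `f g' = c`, `f g'' ∉ D`, `f g'' ≠ c`. [cite: MochizukiSemiAnbd2006, Lem. 1.8(ii) p.20] -/
theorem exists_crossing_of_walk {G G' : SemiGraph.{u}} (f : G.Node → G'.Node)
    (hf : ∀ x y : G.Node, G.subdivision.Adj x y → G'.subdivision.Adj (f x) (f y)) (c : G'.Node) (D : Set G'.Node)
    (hD : ∀ n n' : G'.Node, n ∈ D → G'.subdivision.Adj n n' → n' ≠ c → n' ∈ D) {t : G.Node} (ht : f t ∉ D)
    (htc : f t ≠ c) : ∀ (n : ℕ) {s : G.Node} (γ : G.subdivision.Walk s t), γ.length = n → f s ∈ D →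
      ∃ g g' g'' : G.Node, g ∈ γ.support ∧ g' ∈ γ.support ∧ g'' ∈ γ.support ∧
        G.subdivision.Adj g g' ∧ G.subdivision.Adj g' g'' ∧ f g ∈ D ∧ f g' = c ∧ f g'' ∉ D ∧ f g'' ≠ c := by
  intro n
  induction n using Nat.strong_induction_on with
  | _ n ih =>
    intro s γ hlen hs
    cases γ with
    | nil => exact absurd hs ht
    | @cons _ s' _ h γ' =>
      rw [Walk.length_cons] at hlen
      by_cases hs' : f s' ∈ D
      · obtain ⟨g, g', g'', hg, hg', hg'', h1, h2, h3, h4, h5, h6⟩ := ih γ'.length (by omega) γ' rfl hs'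
        exact ⟨g, g', g'', List.mem_cons_of_mem _ hg, List.mem_cons_of_mem _ hg', List.mem_cons_of_mem _ hg'',
          h1, h2, h3, h4, h5, h6⟩
      · have hs'c : f s' = c := by
          by_contra hne
          exact hs' (hD _ _ hs (hf _ _ h) hne)
        cases γ' with
        | nil => exact absurd hs'c htc
        | @cons _ s'' _ h' γ'' =>
          rw [Walk.length_cons] at hlen
          have hs''c : f s'' ≠ c := by
            rw [← hs'c]
            exact (hf _ _ h').ne.symm
          by_cases hs'' : f s'' ∈ D
          · obtain ⟨g, g', g'', hg, hg', hg'', h1, h2, h3, h4, h5, h6⟩ :=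
              ih γ''.length (by omega) γ'' rfl hs''
            exact ⟨g, g', g'', List.mem_cons_of_mem _ (List.mem_cons_of_mem _ hg),
              List.mem_cons_of_mem _ (List.mem_cons_of_mem _ hg'),
              List.mem_cons_of_mem _ (List.mem_cons_of_mem _ hg''), h1, h2, h3, h4, h5, h6⟩
          · exact ⟨s, s', s'', by simp, by simp, by simp, h, h', hs, hs'c, hs'', hs''c⟩

variable {T : SemiGraph.{u}}

/-- **Walks to `a₀` through the edge-point of `e₀` pass the vertex of the `a₀`-side branch.**  Let `b₁ ≠ b₂` be the
branches of `e₀`, `b₁` abutting to `z₁`, and suppose every walk from the point of `b₂` to `a₀` passes the point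
of `e₀`.  Then every walk to `a₀` passing the point of `e₀` passes `z₁`. [cite: MochizukiSemiAnbd2006, Lem. 1.8(ii) p.20] -/
theorem inl_mem_support_of_edge_mem_support {a₀ z₁ : T.Vertex} {e₀ : T.Edge} {b₁ b₂ : T.Branch} (h12 : b₁ ≠ b₂)
    (hb₁ : T.edgeOf b₁ = e₀) (hb₂ : T.edgeOf b₂ = e₀) (hz₁ : T.abuts b₁ = some z₁)
    (hb₂R : ∀ q : T.subdivision.Walk (Sum.inr (Sum.inr b₂)) (Sum.inl a₀),
      (Sum.inr (Sum.inl e₀) : T.Node) ∈ q.support)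
    {x y : T.Node} (r : T.subdivision.Walk x y) (hy : y = Sum.inl a₀)
    (hr : (Sum.inr (Sum.inl e₀) : T.Node) ∈ r.support) :
    (Sum.inl z₁ : T.Node) ∈ r.support := by
  induction r with
  | nil =>
    subst hy
    simp at hr
  | @cons x x' _ h r' ih =>
    rw [Walk.support_cons, List.mem_cons]
    by_cases hr' : (Sum.inr (Sum.inl e₀) : T.Node) ∈ r'.support
    · exact Or.inr (ih hy hr')
    · rw [Walk.support_cons, List.mem_cons] at hr
      have hx : x = Sum.inr (Sum.inl e₀) := by
        rcases hr with hr | hr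
        · exact hr.symm
        · exact absurd hr hr'
      subst hx
      obtain ⟨b, hbe, rfl⟩ := (T.subdivision_adj_edge_iff e₀ x').mp h
      rcases eq_or_eq_of_edgeOf_eq h12 (hb₁.trans hb₂.symm) (hbe.trans hb₁.symm) with hbb | hbb
      · -- through `b₁`: the next node is the point of `e₀` (excluded) or `z₁`
        right
        have hzb : T.abuts b = some z₁ := by rw [hbb]; exact hz₁
        cases r' with
        | nil => exact absurd hy (by simp)
        | @cons _ x'' _ h' r'' =>
          rcases (T.subdivision_adj_branch_iff b x'').mp h' with hx'' | ⟨v, hv, hx''⟩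
          · exfalso
            apply hr'
            rw [Walk.support_cons]
            refine List.mem_cons_of_mem _ ?_
            have hx''e : x'' = Sum.inr (Sum.inl e₀) := by rw [hx'', hbe]
            rw [← hx''e]
            exact r''.start_mem_support
          · have hvz : v = z₁ := Option.some.inj (hv.symm.trans hzb)
            rw [Walk.support_cons]
            refine List.mem_cons_of_mem _ ?_
            rw [← hvz, ← hx'']
            exact r''.start_mem_support
      · -- through `b₂`: the rest of the walk avoids the point of `e₀`, impossible
        refine absurd (hb₂R (r'.copy (by rw [hbb]) hy)) ?_
        rw [Walk.support_copy]
        exact hr'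

end SemiGraph

namespace ProfiniteSemiGraph

variable {𝒢 : ProfiniteSemiGraph.{u}}

/-! ### The separating edge of a level without common fixed vertex, oriented -/

/-- **The separating edge, oriented.**  If `K₁` fixes `a₀`, `K₂` fixes `b₀` and `K₁`, `K₂` fix no common vertex
of `𝒢_{∞,m}`, there is an edge `e₀` whose point lies on every walk from a `K₁`-fixed to a `K₂`-fixed vertex
(Lemma 1.8 (ii), family form), with branches `b₁ ≠ b₂` abutting to `z₁`, `z₂`, where `z₁` reaches `a₀` and `z₂`
reaches `b₀` avoiding the point of `e₀`, while every walk from the point of `b₂` to `a₀`, or from the point of `b₁`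
to `b₀`, passes it. [cite: MochizukiSemiAnbd2006, Lem. 1.8(ii)(b) p.20] -/
theorem exists_separating_edge_data (h36 : 𝒢.Prop36Hypotheses)
    (K₁ K₂ : Subgroup ((𝒢.galoisLevelData h36).temperedPi h36.isCountable)) (m : ℕ)
    (hno : ∀ z : ((𝒢.galoisLevelData h36).tree m).Vertex,
      (∀ k ∈ K₁, ((𝒢.galoisLevelData h36).treeAct h36.isCountable m k).hom.vertexMap z = z) →
        ¬ ∀ k ∈ K₂, ((𝒢.galoisLevelData h36).treeAct h36.isCountable m k).hom.vertexMap z = z)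
    {a₀ b₀ : ((𝒢.galoisLevelData h36).tree m).Vertex}
    (ha₀ : ∀ k ∈ K₁, ((𝒢.galoisLevelData h36).treeAct h36.isCountable m k).hom.vertexMap a₀ = a₀)
    (hb₀ : ∀ k ∈ K₂, ((𝒢.galoisLevelData h36).treeAct h36.isCountable m k).hom.vertexMap b₀ = b₀) :
    ∃ (e₀ : ((𝒢.galoisLevelData h36).tree m).Edge) (b₁ b₂ : ((𝒢.galoisLevelData h36).tree m).Branch)
      (z₁ z₂ : ((𝒢.galoisLevelData h36).tree m).Vertex),
      b₁ ≠ b₂ ∧ ((𝒢.galoisLevelData h36).tree m).edgeOf b₁ = e₀ ∧ ((𝒢.galoisLevelData h36).tree m).edgeOf b₂ = e₀ ∧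
      ((𝒢.galoisLevelData h36).tree m).abuts b₁ = some z₁ ∧ ((𝒢.galoisLevelData h36).tree m).abuts b₂ = some z₂ ∧
      (∀ a b : ((𝒢.galoisLevelData h36).tree m).Vertex,
        (∀ k ∈ K₁, ((𝒢.galoisLevelData h36).treeAct h36.isCountable m k).hom.vertexMap a = a) →
        (∀ k ∈ K₂, ((𝒢.galoisLevelData h36).treeAct h36.isCountable m k).hom.vertexMap b = b) →
        ∀ w : ((𝒢.galoisLevelData h36).tree m).subdivision.Walk (Sum.inl a) (Sum.inl b),
          (Sum.inr (Sum.inl e₀) : ((𝒢.galoisLevelData h36).tree m).Node) ∈ w.support) ∧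
      (∃ p : ((𝒢.galoisLevelData h36).tree m).subdivision.Walk (Sum.inl z₁) (Sum.inl a₀),
        (Sum.inr (Sum.inl e₀) : ((𝒢.galoisLevelData h36).tree m).Node) ∉ p.support) ∧
      (∀ q : ((𝒢.galoisLevelData h36).tree m).subdivision.Walk (Sum.inr (Sum.inr b₂)) (Sum.inl a₀),
        (Sum.inr (Sum.inl e₀) : ((𝒢.galoisLevelData h36).tree m).Node) ∈ q.support) ∧
      (∃ p : ((𝒢.galoisLevelData h36).tree m).subdivision.Walk (Sum.inl z₂) (Sum.inl b₀),
        (Sum.inr (Sum.inl e₀) : ((𝒢.galoisLevelData h36).tree m).Node) ∉ p.support) ∧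
      (∀ q : ((𝒢.galoisLevelData h36).tree m).subdivision.Walk (Sum.inr (Sum.inr b₁)) (Sum.inl b₀),
        (Sum.inr (Sum.inl e₀) : ((𝒢.galoisLevelData h36).tree m).Node) ∈ q.support) := by
  classical
  let Dg := 𝒢.galoisLevelData h36
  have hc := h36.isCountable
  let T := Dg.tree m
  -- the separating edge `e₀` (Lemma 1.8 (ii), family form)
  obtain ⟨e₀, he₀⟩ := SemiGraph.exists_edge_forall_walk_mem_support_of_family' (Dg.isTree_tree m)
    ((fun k => Dg.treeAct hc m k) '' (K₁ : Set (Dg.temperedPi hc)))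
    ((fun k => Dg.treeAct hc m k) '' (K₂ : Set (Dg.temperedPi hc)))
    (by
      rintro _ ⟨k, -, rfl⟩ e hef β hβ
      exact SemiGraph.branchMap_eq_of_over_aut (Dg.treeProj m) (Dg.treeAct hc m k) (Dg.treeAct_over hc m k) β
        (by rw [hβ]; exact hef))
    (by
      rintro _ ⟨k, -, rfl⟩ e hef β hβ
      exact SemiGraph.branchMap_eq_of_over_aut (Dg.treeProj m) (Dg.treeAct hc m k) (Dg.treeAct_over hc m k) β
        (by rw [hβ]; exact hef))
    (a₀ := a₀) (b₀ := b₀)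
    (by rintro _ ⟨k, hk, rfl⟩; exact ha₀ k hk) (by rintro _ ⟨k, hk, rfl⟩; exact hb₀ k hk)
    (by
      intro z hz hz'
      exact hno z (fun k hk => hz _ ⟨k, hk, rfl⟩) (fun k hk => hz' _ ⟨k, hk, rfl⟩))
  have hsep : ∀ a b : T.Vertex, (∀ k ∈ K₁, (Dg.treeAct hc m k).hom.vertexMap a = a) →
      (∀ k ∈ K₂, (Dg.treeAct hc m k).hom.vertexMap b = b) →
      ∀ w : T.subdivision.Walk (Sum.inl a) (Sum.inl b), (Sum.inr (Sum.inl e₀) : T.Node) ∈ w.support :=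
    fun a b ha hb w => he₀ a b (by rintro _ ⟨k, hk, rfl⟩; exact ha k hk) (by rintro _ ⟨k, hk, rfl⟩; exact hb k hk) w
  -- the sides: nodes reaching `a₀`, resp. `b₀`, avoiding the point of `e₀`
  let c : T.Node := Sum.inr (Sum.inl e₀)
  let DA : Set T.Node := {n | ∃ p : T.subdivision.Walk n (Sum.inl a₀), c ∉ p.support}
  let DB : Set T.Node := {n | ∃ p : T.subdivision.Walk n (Sum.inl b₀), c ∉ p.support}
  have hDA : ∀ n n' : T.Node, n ∈ DA → T.subdivision.Adj n n' → n' ≠ c → n' ∈ DA := by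
    rintro n n' ⟨p, hp⟩ hnn' hn'
    refine ⟨Walk.cons hnn'.symm p, ?_⟩
    rw [Walk.support_cons, List.mem_cons, not_or]
    exact ⟨fun h => hn' h.symm, hp⟩
  have hDB : ∀ n n' : T.Node, n ∈ DB → T.subdivision.Adj n n' → n' ≠ c → n' ∈ DB := by
    rintro n n' ⟨p, hp⟩ hnn' hn'
    refine ⟨Walk.cons hnn'.symm p, ?_⟩
    rw [Walk.support_cons, List.mem_cons, not_or]
    exact ⟨fun h => hn' h.symm, hp⟩
  have ha₀A : (Sum.inl a₀ : T.Node) ∈ DA := ⟨Walk.nil, by simp [c]⟩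
  have hb₀B : (Sum.inl b₀ : T.Node) ∈ DB := ⟨Walk.nil, by simp [c]⟩
  have hb₀A : (Sum.inl b₀ : T.Node) ∉ DA := by
    rintro ⟨p, hp⟩
    apply hp
    have h := hsep a₀ b₀ ha₀ hb₀ p.reverse
    rwa [Walk.support_reverse, List.mem_reverse] at h
  have ha₀B : (Sum.inl a₀ : T.Node) ∉ DB := by
    rintro ⟨p, hp⟩
    exact hp (hsep a₀ b₀ ha₀ hb₀ p)
  -- the geodesic `[a₀, b₀]` crosses the point of `e₀`: orient the branches
  obtain ⟨γ₀, -, -⟩ := ((Dg.isTree_tree m).isTree.connected (Sum.inl a₀ : T.Node) (Sum.inl b₀)).exists_path_of_dist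
  obtain ⟨g, g', g'', -, -, -, hgg', hg'g'', hgA, hg'c, hg''A, -⟩ :=
    SemiGraph.exists_crossing_of_walk (G := T) (G' := T) id (fun _ _ h => h) c DA hDA hb₀A (by simp [c])
      γ₀.length γ₀ rfl ha₀A
  change g' = c at hg'c
  subst hg'c
  obtain ⟨b₁, hb₁, rfl⟩ := (T.subdivision_adj_edge_iff e₀ g).mp hgg'.symm
  obtain ⟨b₂, hb₂, rfl⟩ := (T.subdivision_adj_edge_iff e₀ g'').mp hg'g''
  change (Sum.inr (Sum.inr b₁) : T.Node) ∈ DA at hgA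
  change (Sum.inr (Sum.inr b₂) : T.Node) ∉ DA at hg''A
  have h12 : b₁ ≠ b₂ := by
    rintro rfl
    exact hg''A hgA
  -- the same from the side of `b₀`
  obtain ⟨g₃, g₄, g₅, -, -, -, h34, h45, hg₃B, hg₄c, hg₅B, -⟩ :=
    SemiGraph.exists_crossing_of_walk (G := T) (G' := T) id (fun _ _ h => h) c DB hDB ha₀B (by simp [c])
      γ₀.reverse.length γ₀.reverse rfl hb₀B
  change g₄ = c at hg₄c
  subst hg₄c
  obtain ⟨b₂', hb₂', rfl⟩ := (T.subdivision_adj_edge_iff e₀ g₃).mp h34.symm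
  change (Sum.inr (Sum.inr b₂') : T.Node) ∈ DB at hg₃B
  -- `b₂' = b₂`: a branch on both sides would join `a₀` to `b₀` avoiding the point of `e₀`
  have hb₂'eq : b₂' = b₂ := by
    rcases SemiGraph.eq_or_eq_of_edgeOf_eq h12 (hb₁.trans hb₂.symm) (hb₂'.trans hb₁.symm) with h | h
    · exfalso
      subst h
      obtain ⟨pA, hpA⟩ := hgA
      obtain ⟨pB, hpB⟩ := hg₃B
      apply hb₀A
      refine ⟨pB.reverse.append pA, ?_⟩
      rw [Walk.support_append, List.mem_append, Walk.support_reverse, List.mem_reverse]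
      rintro (h | h)
      · exact hpB h
      · exact hpA (List.tail_subset _ h)
    · exact h
  rw [hb₂'eq] at hg₃B
  have hb₁B : (Sum.inr (Sum.inr b₁) : T.Node) ∉ DB := by
    obtain ⟨b₁', hb₁', h5⟩ := (T.subdivision_adj_edge_iff e₀ g₅).mp h45
    rcases SemiGraph.eq_or_eq_of_edgeOf_eq h12 (hb₁.trans hb₂.symm) (hb₁'.trans hb₁.symm) with h | h
    · rw [← h, ← h5]; exact hg₅B
    · exfalso
      subst h
      exact hg₅B (h5 ▸ hg₃B)
  -- the vertices `z₁`, `z₂`: the second node of a walk from the branch point avoiding the point of `e₀`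
  have hvert : ∀ (b : T.Branch) (a : T.Vertex) (p : T.subdivision.Walk (Sum.inr (Sum.inr b)) (Sum.inl a)),
      c ∉ p.support → T.edgeOf b = e₀ → ∃ (z : T.Vertex) (p' : T.subdivision.Walk (Sum.inl z) (Sum.inl a)),
        T.abuts b = some z ∧ c ∉ p'.support := by
    intro b a p hp hb
    cases p with
    | @cons _ x' _ h p' =>
      rw [Walk.support_cons, List.mem_cons, not_or] at hp
      rcases (T.subdivision_adj_branch_iff b x').mp h with hx' | ⟨z, hz, hx'⟩
      · exfalso
        apply hp.2
        have hx'e : x' = c := by rw [hx', hb]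
        rw [← hx'e]
        exact p'.start_mem_support
      · subst hx'
        exact ⟨z, p', hz, hp.2⟩
  obtain ⟨pA, hpA⟩ := hgA
  obtain ⟨z₁, p₁, hz₁, hp₁⟩ := hvert b₁ a₀ pA hpA hb₁
  obtain ⟨pB, hpB⟩ := hg₃B
  obtain ⟨z₂, p₂, hz₂, hp₂⟩ := hvert b₂ b₀ pB hpB hb₂
  refine ⟨e₀, b₁, b₂, z₁, z₂, h12, hb₁, hb₂, hz₁, hz₂, hsep, ⟨p₁, hp₁⟩, fun q => ?_, ⟨p₂, hp₂⟩, fun q => ?_⟩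
  · by_contra hq
    exact hg''A ⟨q, hq⟩
  · by_contra hq
    exact hb₁B ⟨q, hq⟩

/-! ### The separating vertex -/

/-- **The separating vertex package.**  With the oriented separating edge as above: if the vertex `z₁` of the
`K₁`-side branch is NOT fixed by `K₁`, then (i) `z₁` is not fixed by `K₂` either, (ii) every walk from a
`K₂`-fixed vertex to `a₀` passes `z₁`, and (iii) every `K₁`-fixed vertex reaches `a₀` avoiding `z₁` (the geodesic
between two `K₁`-fixed vertices is fixed node-wise by `K₁`). [cite: MochizukiSemiAnbd2006, Lem. 1.8(ii)(b) p.20] -/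
theorem separating_vertex_package (h36 : 𝒢.Prop36Hypotheses)
    (K₁ K₂ : Subgroup ((𝒢.galoisLevelData h36).temperedPi h36.isCountable)) (m : ℕ)
    {e₀ : ((𝒢.galoisLevelData h36).tree m).Edge} {b₁ b₂ : ((𝒢.galoisLevelData h36).tree m).Branch}
    {z₁ a₀ : ((𝒢.galoisLevelData h36).tree m).Vertex} (h12 : b₁ ≠ b₂)
    (hb₁ : ((𝒢.galoisLevelData h36).tree m).edgeOf b₁ = e₀) (hb₂ : ((𝒢.galoisLevelData h36).tree m).edgeOf b₂ = e₀)
    (hz₁ : ((𝒢.galoisLevelData h36).tree m).abuts b₁ = some z₁)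
    (ha₀ : ∀ k ∈ K₁, ((𝒢.galoisLevelData h36).treeAct h36.isCountable m k).hom.vertexMap a₀ = a₀)
    (hsep : ∀ a b : ((𝒢.galoisLevelData h36).tree m).Vertex,
      (∀ k ∈ K₁, ((𝒢.galoisLevelData h36).treeAct h36.isCountable m k).hom.vertexMap a = a) →
      (∀ k ∈ K₂, ((𝒢.galoisLevelData h36).treeAct h36.isCountable m k).hom.vertexMap b = b) →
      ∀ w : ((𝒢.galoisLevelData h36).tree m).subdivision.Walk (Sum.inl a) (Sum.inl b),
        (Sum.inr (Sum.inl e₀) : ((𝒢.galoisLevelData h36).tree m).Node) ∈ w.support)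
    (hp₁ : ∃ p : ((𝒢.galoisLevelData h36).tree m).subdivision.Walk (Sum.inl z₁) (Sum.inl a₀),
      (Sum.inr (Sum.inl e₀) : ((𝒢.galoisLevelData h36).tree m).Node) ∉ p.support)
    (hb₂R : ∀ q : ((𝒢.galoisLevelData h36).tree m).subdivision.Walk (Sum.inr (Sum.inr b₂)) (Sum.inl a₀),
      (Sum.inr (Sum.inl e₀) : ((𝒢.galoisLevelData h36).tree m).Node) ∈ q.support)
    (hz₁K : ¬ ∀ k ∈ K₁, ((𝒢.galoisLevelData h36).treeAct h36.isCountable m k).hom.vertexMap z₁ = z₁) :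
    (¬ ∀ k ∈ K₂, ((𝒢.galoisLevelData h36).treeAct h36.isCountable m k).hom.vertexMap z₁ = z₁) ∧
    (∀ b : ((𝒢.galoisLevelData h36).tree m).Vertex,
      (∀ k ∈ K₂, ((𝒢.galoisLevelData h36).treeAct h36.isCountable m k).hom.vertexMap b = b) →
      ∀ q : ((𝒢.galoisLevelData h36).tree m).subdivision.Walk (Sum.inl b) (Sum.inl a₀),
        (Sum.inl z₁ : ((𝒢.galoisLevelData h36).tree m).Node) ∈ q.support) ∧
    ∀ a : ((𝒢.galoisLevelData h36).tree m).Vertex,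
      (∀ k ∈ K₁, ((𝒢.galoisLevelData h36).treeAct h36.isCountable m k).hom.vertexMap a = a) →
      ∃ p : ((𝒢.galoisLevelData h36).tree m).subdivision.Walk (Sum.inl a) (Sum.inl a₀),
        (Sum.inl z₁ : ((𝒢.galoisLevelData h36).tree m).Node) ∉ p.support := by
  classical
  let Dg := 𝒢.galoisLevelData h36
  have hc := h36.isCountable
  let T := Dg.tree m
  obtain ⟨p₁, hp₁⟩ := hp₁
  refine ⟨fun hz₁K₂ => ?_, fun b hb q => ?_, fun a ha => ?_⟩
  · -- (i) `z₁` fixed by `K₂` would be joined to `a₀` avoiding the point of `e₀`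
    have h := hsep a₀ z₁ ha₀ hz₁K₂ p₁.reverse
    rw [Walk.support_reverse, List.mem_reverse] at h
    exact hp₁ h
  · -- (ii) walks from `K₂`-fixed vertices to `a₀` pass the point of `e₀`, hence `z₁`
    have h := hsep a₀ b ha₀ hb q.reverse
    rw [Walk.support_reverse, List.mem_reverse] at h
    exact SemiGraph.inl_mem_support_of_edge_mem_support h12 hb₁ hb₂ hz₁ hb₂R q rfl h
  · -- (iii) the geodesic between two `K₁`-fixed vertices is `K₁`-fixed node-wise, so avoids `z₁`
    obtain ⟨p, hp, -⟩ := ((Dg.isTree_tree m).isTree.connected (Sum.inl a : T.Node) (Sum.inl a₀)).exists_path_of_dist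
    refine ⟨p, fun hmem => hz₁K fun k hk => ?_⟩
    have h := SemiGraph.nodeMap_eq_self_of_isPath (Dg.isTree_tree m).isTree.isAcyclic (Dg.treeAct hc m k)
      (by rw [SemiGraph.nodeMap_inl, ha k hk]) (by rw [SemiGraph.nodeMap_inl, ha₀ k hk]) p hp _ hmem
    simpa only [SemiGraph.nodeMap_inl, Sum.inl.injEq] using h

end ProfiniteSemiGraph

end Literature.AnabelianGeometry.SemiGraphs

end
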